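import Mathlib
import Literature.Analysis.ODE.NearInverseSquareTrueChainHalf
import Literature.Analysis.PDE.TowerChannelEnergy

/-!
# The static true kernel element for `n = 0`, RELATIVELY close to the constant datum

Analysis/PDE support file (everything proved). For `n = 0` the exact far kernel datum is the
constant `(1, 0)`, whose `W`-energy `∫_{x>1} W` may be arbitrarily small; the kernel element
approximating it must therefore be close RELATIVE to `∫_{x>1} W`. Let `W ≥ 0` be continuous with
`|W| ≤ ε_K x^{-5/2}` on `[½,∞)`, and let `U` be the recessive solution (`U → 1`) of the modified
rescaled equation `U'' = P♯ U` of `NearInverseSquareTrueChainHalf.exists_recessive_modified`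
(`P♯ = q♯ = χ·W(·/4)/16 ≥ 0` here). The static function `B(t,x) = U(4x)` is a global `C²` solution of
`B_tt − B_xx + W B = 0` on `{x ≥ 1}`, `t`-polynomial (constant in `t`), with energy density
`O(x⁻²)` (hence non-radiating), and

  `∫_{x>1} [16 U'(4x)² + W (1 − U(4x))²] ≤ 10 ε_K ∫_{x>1} W`,

because `|U'(z)| ≤ (3/2)∫_z^∞ q♯` (from `U' (∞) = 0`), `∫_z^∞ q♯ ≤ 4ε_K z^{-3/2}`,
`∫_4^∞ q♯ ≤ ¼∫_1^∞ W`, and `|1 − U| ≤ 12 ε_K z^{-1/2}` (`exists_farKernelElement_zero`, with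
`ε_K = min(1/64, δ²/16)` for a prescribed relative accuracy `δ`). Route PhotonSphereChannels,
`FixedModeChannels`, far side, `n = 0` (stmt-FinalStateConjecture-10048). Folklore.
-/

noncomputable section

namespace Literature.Analysis.PDE

open Set Filter MeasureTheory Finset Literature.Analysis.ODE
open scoped Topology

variable {ι : ℝ → ℝ}

/-- **The `n = 0` kernel element with relative closeness.** See the module docstring.
[folklore] -/
theorem exists_farKernelElement_zero {δ : ℝ} (hδ : 0 < δ) :
    ∃ εK : ℝ, 0 < εK ∧ εK ≤ 1 / 4 ∧ ∀ {W : ℝ → ℝ}, Continuous W → (∀ x, 0 ≤ W x) →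
      (∀ x : ℝ, 1 / 2 ≤ x →
        |W x - ((0 : ℕ) : ℝ) * (((0 : ℕ) : ℝ) + 1) / x ^ 2| ≤ εK * x ^ (-(5 : ℝ) / 2)) →
      ∃ B : ℝ → ℝ → ℝ, ContDiff ℝ 2 (Function.uncurry B) ∧
        (∀ t x, 1 ≤ x →
          iteratedDeriv 2 (fun τ => B τ x) t - iteratedDeriv 2 (B t) x + W x * B t x = 0) ∧
        IntegrableOn (fun x => deriv (fun τ => B τ x) 0 ^ 2 + deriv (B 0) x ^ 2
          + W x * B 0 x ^ 2) (Ioi 1) ∧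
        Tendsto (fun t => ∫ x in Ioi (1 + |t|), (deriv (fun τ => B τ x) t ^ 2
          + deriv (B t) x ^ 2 + W x * B t x ^ 2)) atTop (𝓝 0) ∧
        Tendsto (fun t => ∫ x in Ioi (1 + |t|), (deriv (fun τ => B τ x) t ^ 2
          + deriv (B t) x ^ 2 + W x * B t x ^ 2)) atBot (𝓝 0) ∧
        (∃ (N : ℕ) (α : ℕ → ℝ → ℝ), ∀ z : ℝ × ℝ, 1 + |z.1| < z.2 →
          B z.1 z.2 = ∑ i ∈ Finset.range N, α i z.2 * z.1 ^ i) ∧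
        Real.sqrt (∫ x in Ioi 1, (deriv (fun y => ι y ^ 0 - B 0 y) x ^ 2
          + W x * (ι x ^ 0 - B 0 x) ^ 2 + deriv (fun τ => B τ x) 0 ^ 2))
        ≤ δ * Real.sqrt (∫ x in Ioi 1, (deriv (fun y => ι y ^ 0) x ^ 2 + W x * (ι x ^ 0) ^ 2)) := by
  set εK : ℝ := min (1 / 64) (δ ^ 2 / 16) with hεK
  have hεK0 : 0 < εK := lt_min (by norm_num) (by positivity)
  have hεK64 : εK ≤ 1 / 64 := min_le_left _ _
  have hεKδ : εK ≤ δ ^ 2 / 16 := min_le_right _ _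
  refine ⟨εK, hεK0, by linarith, ?_⟩
  intro W hW hW0 hclose
  obtain ⟨Ps, q, U, hPsc, hqc, -, hPs3, hqb, hq2, hqdef, hPsdef, hU, hU0, hU1⟩ :=
    exists_recessive_modified 0 hW hεK0.le (by linarith) hclose
  -- clean-up at `n = 0`
  have hPsq : ∀ y, Ps y = q y := fun y => by rw [hPsdef y]; simp
  have hqW : ∀ y, 0 ≤ q y ∧ q y ≤ W (y / 4) / 16 := by
    intro y
    have hχ0 : 0 ≤ min 1 (max 0 (y - 2)) := le_min zero_le_one (le_max_left _ _)
    have hχ1 : min 1 (max 0 (y - 2)) ≤ 1 := min_le_left _ _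
    have hWy : 0 ≤ W (y / 4) / 16 := div_nonneg (hW0 _) (by norm_num)
    rw [hqdef y]
    simp only [Nat.cast_zero, zero_mul, zero_div, sub_zero]
    exact ⟨mul_nonneg hχ0 hWy, by nlinarith⟩
  have hUb : ∀ z : ℝ, 1 < z → |U z - 1| ≤ 12 * εK * z ^ (-(1 : ℝ) / 2) ∧ |U z| ≤ 3 / 2 ∧
      |deriv U z| ≤ 8 * εK * z⁻¹ := by
    intro z hz
    have hz0 : 0 < z := by linarith
    have h0 := hU0 z hz
    rw [pow_zero, one_mul] at h0
    have h1 := hU1 z hz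
    simp only [zero_mul, add_zero, CharP.cast_eq_zero, neg_zero, zero_sub,
      zpow_neg_one] at h1
    have hzh : z ^ (-(1 : ℝ) / 2) ≤ 1 := Real.rpow_le_one_of_one_le_of_nonpos hz.le (by norm_num)
    have hzh0 : 0 ≤ z ^ (-(1 : ℝ) / 2) := Real.rpow_nonneg hz0.le _
    refine ⟨h0, ?_, ?_⟩
    · have : |U z - 1| ≤ 1 / 2 := h0.trans (by nlinarith)
      have h' := abs_sub_abs_le_abs_sub (U z) 1
      rw [abs_one] at h'
      linarith
    · calc |deriv U z| ≤ 8 * εK * z ^ (-(1 : ℝ) / 2) * z⁻¹ := h1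
        _ ≤ 8 * εK * 1 * z⁻¹ := by gcongr
        _ = 8 * εK * z⁻¹ := by ring
  -- `U` is `C²`
  have hU'' : ∀ s, HasDerivAt (deriv U) (q s * U s) s := fun s => by
    have h := hU.hasDerivAt_deriv s; rwa [hPsq s] at h
  have hU2 : ContDiff ℝ 2 U := by
    rw [show (2 : WithTop ℕ∞) = 1 + 1 by norm_num, contDiff_succ_iff_deriv]
    refine ⟨hU.differentiable, fun h => absurd h (by simp), ?_⟩
    rw [show (1 : WithTop ℕ∞) = 0 + 1 by norm_num, contDiff_succ_iff_deriv]
    refine ⟨hU.differentiable_deriv, fun h => absurd h (by simp), ?_⟩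
    have : deriv (deriv U) = fun s => q s * U s := funext fun s => (hU'' s).deriv
    rw [this]; exact contDiff_zero.2 (hqc.mul hU.continuous)
  -- the static element `B(t,x) = U(4x)` and its derivatives
  set B : ℝ → ℝ → ℝ := fun _ x => U (4 * x) with hB
  have hlin : ∀ x : ℝ, HasDerivAt (fun y : ℝ => 4 * y) 4 x := fun x => by
    simpa using (hasDerivAt_id x).const_mul (4 : ℝ)
  have hBx : ∀ x, HasDerivAt (fun y => U (4 * y)) (4 * deriv U (4 * x)) x := fun x => by
    have h := (hU.hasDerivAt (4 * x)).comp x (hlin x)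
    refine h.congr_deriv ?_; ring
  have hBx' : deriv (fun y => U (4 * y)) = fun x => 4 * deriv U (4 * x) := funext fun x => (hBx x).deriv
  have hBxx : ∀ x, HasDerivAt (fun y => 4 * deriv U (4 * y)) (16 * (q (4 * x) * U (4 * x))) x := by
    intro x
    have h := ((hU'' (4 * x)).comp x (hlin x)).const_mul (4 : ℝ)
    refine h.congr_deriv ?_; ring
  have hBC : ContDiff ℝ 2 (Function.uncurry B) := hU2.comp (contDiff_const.mul contDiff_snd)
  have hdens : ∀ t x, deriv (fun τ => B τ x) t ^ 2 + deriv (B t) x ^ 2 + W x * B t x ^ 2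
      = 16 * deriv U (4 * x) ^ 2 + W x * U (4 * x) ^ 2 := by
    intro t x
    simp only [hB, deriv_const, hBx']
    ring
  -- pointwise energy bound on `[1,∞)`
  have hWb : ∀ x : ℝ, 1 ≤ x → W x ≤ εK * (x ^ 2)⁻¹ ∧ IntegrableOn W (Ioi 1) := by
    intro x hx
    have hpt : ∀ y : ℝ, 1 ≤ y → W y ≤ εK * y ^ (-(5 : ℝ) / 2) := fun y hy => by
      have h := (abs_le.1 (hclose y (by linarith))).2
      simp only [Nat.cast_zero, zero_mul, zero_div, sub_zero] at h
      exact h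
    have hx0 : 0 < x := by linarith
    refine ⟨(hpt x hx).trans ?_, ?_⟩
    · rw [← Real.rpow_two, ← Real.rpow_neg hx0.le]
      exact mul_le_mul_of_nonneg_left (Real.rpow_le_rpow_of_exponent_le hx (by norm_num)) hεK0.le
    · refine Integrable.mono' ((integrableOn_Ioi_rpow_of_lt (a := -(5 : ℝ) / 2) (by norm_num)
        one_pos).const_mul εK) hW.aestronglyMeasurable
        ((ae_restrict_iff' measurableSet_Ioi).2 (ae_of_all _ fun y hy => ?_))
      rw [Real.norm_eq_abs, abs_of_nonneg (hW0 y)]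
      exact hpt y (le_of_lt hy)
  have hbd : ∀ t x, 1 + |t| < x → deriv (fun τ => B τ x) t ^ 2 + deriv (B t) x ^ 2 + W x * B t x ^ 2
      ≤ (64 * εK ^ 2 + 4 * εK) * x ^ (-(2 : ℝ)) := by
    intro t x hx
    have hx1 : 1 < x := by linarith [abs_nonneg t]
    have hx0 : 0 < x := by linarith
    rw [hdens, Real.rpow_neg hx0.le, Real.rpow_two]
    obtain ⟨-, hUa, hU'a⟩ := hUb (4 * x) (by linarith)
    obtain ⟨hWx, -⟩ := hWb x hx1.le
    have h1 : deriv U (4 * x) ^ 2 ≤ (8 * εK * (4 * x)⁻¹) ^ 2 := by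
      rw [← sq_abs]; exact pow_le_pow_left₀ (abs_nonneg _) hU'a 2
    have h2 : U (4 * x) ^ 2 ≤ (3 / 2) ^ 2 := by
      rw [← sq_abs]; exact pow_le_pow_left₀ (abs_nonneg _) hUa 2
    have h3 : W x * U (4 * x) ^ 2 ≤ εK * (x ^ 2)⁻¹ * (3 / 2) ^ 2 :=
      mul_le_mul hWx h2 (sq_nonneg _) (by positivity)
    have e : (8 * εK * (4 * x)⁻¹) ^ 2 = 4 * εK ^ 2 * (x ^ 2)⁻¹ := by field_simp; ring
    rw [e] at h1
    have hx2 : 0 < (x ^ 2)⁻¹ := by positivity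
    nlinarith
  obtain ⟨hint, -, hT, hBo⟩ := wave1D_farEnergy_tendsto_zero_base hW hW0 hBC (ρ := 1) le_rfl hbd
  have hint0 := hint 0
  rw [abs_zero, add_zero] at hint0
  -- the tail functional `T z = ∫_z^∞ q`
  have hqabs : ∀ y, |q y| = q y := fun y => abs_of_nonneg (hqW y).1
  have hqb' : ∀ y : ℝ, 1 ≤ y → |q y| ≤ 2 * εK * y ^ (-(5 : ℝ) / 2) := hqb
  obtain ⟨-, htail⟩ := modifiedTail_integral hqc hqb'
  have hqi : ∀ z : ℝ, 1 ≤ z → IntegrableOn q (Ioi z) := by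
    intro z hz
    have hz0 : 0 < z := by linarith
    refine Integrable.mono' ((integrableOn_Ioi_rpow_of_lt (a := -(5 : ℝ) / 2) (by norm_num)
      hz0).const_mul (2 * εK)) hqc.aestronglyMeasurable
      ((ae_restrict_iff' measurableSet_Ioi).2 (ae_of_all _ fun y hy => ?_))
    rw [Real.norm_eq_abs]
    exact hqb' y (hz.trans (le_of_lt hy))
  have hT32 : ∀ z : ℝ, 1 ≤ z → ∫ s in Ioi z, q s ≤ 4 * εK * z ^ (-(3 : ℝ) / 2) := by
    intro z hz
    have hz0 : 0 < z := by linarith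
    obtain ⟨hi, hle⟩ := htail z hz
    have h1 : ∫ s in Ioi z, q s ≤ ∫ s in Ioi z, z⁻¹ * (s * |q s|) := by
      refine setIntegral_mono_on (hqi z hz) (hi.const_mul _) measurableSet_Ioi fun s hs => ?_
      rw [hqabs]
      have hs : z ≤ s := le_of_lt hs
      have hq0 := (hqW s).1
      rw [← mul_assoc]
      have : 1 ≤ z⁻¹ * s := by rw [inv_mul_eq_div, one_le_div hz0]; exact hs
      nlinarith
    rw [integral_const_mul] at h1
    calc ∫ s in Ioi z, q s ≤ z⁻¹ * ∫ s in Ioi z, s * |q s| := h1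
      _ ≤ z⁻¹ * (4 * εK * z ^ (-(1 : ℝ) / 2)) := mul_le_mul_of_nonneg_left hle (inv_pos.2 hz0).le
      _ = 4 * εK * (z ^ (-(1 : ℝ)) * z ^ (-(1 : ℝ) / 2)) := by rw [Real.rpow_neg_one]; ring
      _ = 4 * εK * z ^ (-(3 : ℝ) / 2) := by rw [← Real.rpow_add hz0]; norm_num
  set R : ℝ := ∫ x in Ioi 1, W x with hR
  have hR0 : 0 ≤ R := setIntegral_nonneg measurableSet_Ioi fun x _ => hW0 x
  have hT4 : ∫ s in Ioi 4, q s ≤ R / 4 := by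
    have hWi4' : IntegrableOn (fun s : ℝ => W (1 / 4 * s)) (Ioi 4) := by
      have h := (hWb 1 le_rfl).2
      refine (integrableOn_Ioi_comp_mul_left_iff (fun s => W s) (4 : ℝ)
        (by norm_num : (0 : ℝ) < 1 / 4)).2 ?_
      rwa [show (1 / 4 : ℝ) * 4 = 1 by norm_num]
    have hWi4 : IntegrableOn (fun s => W (s / 4) / 16) (Ioi 4) := by
      have e : (fun s : ℝ => W (s / 4) / 16) = fun s => (1 / 16) * W (1 / 4 * s) := by
        funext s; rw [show (1 / 4 : ℝ) * s = s / 4 by ring]; ring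
      rw [e]; exact hWi4'.const_mul _
    calc ∫ s in Ioi 4, q s ≤ ∫ s in Ioi 4, W (s / 4) / 16 :=
          setIntegral_mono_on (hqi 4 (by norm_num)) hWi4 measurableSet_Ioi fun s _ => (hqW s).2
      _ = (1 / 16) * ∫ s in Ioi (4 : ℝ), W ((1 / 4) * s) := by
          rw [← integral_const_mul]
          refine setIntegral_congr_fun measurableSet_Ioi fun s _ => ?_
          rw [show (1 / 4 : ℝ) * s = s / 4 by ring]; ring
      _ = R / 4 := by
          rw [integral_comp_mul_left_Ioi (fun s => W s) 4 (by norm_num : (0 : ℝ) < 1 / 4)]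
          norm_num [hR]
          ring
  -- `U' = -∫ q U` beyond `1`, hence `|U'| ≤ (3/2) T`
  have hU'T : ∀ z : ℝ, 1 < z → |deriv U z| ≤ 3 / 2 * ∫ s in Ioi z, q s := by
    intro z hz
    have hqUi : IntegrableOn (fun s => q s * U s) (Ioi z) := by
      refine Integrable.mono' ((hqi z hz.le).const_mul (3 / 2)) (hqc.mul hU.continuous).aestronglyMeasurable
        ((ae_restrict_iff' measurableSet_Ioi).2 (ae_of_all _ fun s hs => ?_))
      rw [Real.norm_eq_abs, abs_mul, hqabs, mul_comm (3 / 2 : ℝ)]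
      exact mul_le_mul_of_nonneg_left (hUb s (hz.trans hs)).2.1 (hqW s).1
    have hlim : Tendsto (deriv U) atTop (𝓝 0) := by
      refine squeeze_zero_norm' ?_ ((tendsto_inv_atTop_zero.const_mul (8 * εK)).trans (by simp))
      filter_upwards [eventually_gt_atTop (1 : ℝ)] with s hs
      rw [Real.norm_eq_abs]; exact (hUb s hs).2.2
    have hftc := integral_Ioi_of_hasDerivAt_of_tendsto (hU.continuous_deriv.continuousWithinAt)
      (fun s _ => hU'' s) hqUi hlim
    rw [zero_sub] at hftc
    have e : deriv U z = -∫ s in Ioi z, q s * U s := by rw [hftc, neg_neg]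
    rw [e, abs_neg]
    calc |∫ s in Ioi z, q s * U s| ≤ ∫ s in Ioi z, |q s * U s| := abs_integral_le_integral_abs
      _ ≤ ∫ s in Ioi z, 3 / 2 * q s := by
          refine setIntegral_mono_on hqUi.abs ((hqi z hz.le).const_mul _) measurableSet_Ioi
            fun s hs => ?_
          rw [abs_mul, hqabs, mul_comm (3 / 2 : ℝ)]
          exact mul_le_mul_of_nonneg_left (hUb s (hz.trans hs)).2.1 (hqW s).1
      _ = 3 / 2 * ∫ s in Ioi z, q s := integral_const_mul _ _
  -- the relative closeness
  have hmain : (∫ x in Ioi 1, (deriv (fun y => ι y ^ 0 - B 0 y) x ^ 2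
      + W x * (ι x ^ 0 - B 0 x) ^ 2 + deriv (fun τ => B τ x) 0 ^ 2)) ≤ 10 * εK * R := by
    have hg : IntegrableOn (fun x : ℝ => 9 / 2 * R * εK * x ^ (-(3 : ℝ) / 2) + 36 * εK ^ 2 * W x)
        (Ioi 1) :=
      ((integrableOn_Ioi_rpow_of_lt (a := -(3 : ℝ) / 2) (by norm_num) one_pos).const_mul _).add
        ((hWb 1 le_rfl).2.const_mul _)
    have hgv : (∫ x in Ioi (1 : ℝ), (9 / 2 * R * εK * x ^ (-(3 : ℝ) / 2) + 36 * εK ^ 2 * W x))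
        = 9 * R * εK + 36 * εK ^ 2 * R := by
      rw [integral_add ((integrableOn_Ioi_rpow_of_lt (a := -(3 : ℝ) / 2) (by norm_num)
        one_pos).const_mul _) ((hWb 1 le_rfl).2.const_mul _), integral_const_mul, integral_const_mul,
        integral_Ioi_rpow_of_lt (by norm_num) one_pos, Real.one_rpow, ← hR]
      norm_num; ring
    calc (∫ x in Ioi 1, (deriv (fun y => ι y ^ 0 - B 0 y) x ^ 2
          + W x * (ι x ^ 0 - B 0 x) ^ 2 + deriv (fun τ => B τ x) 0 ^ 2))
        ≤ ∫ x in Ioi (1 : ℝ), (9 / 2 * R * εK * x ^ (-(3 : ℝ) / 2) + 36 * εK ^ 2 * W x) := by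
          refine integral_mono_of_nonneg (ae_of_all _ fun x => add_nonneg (add_nonneg (sq_nonneg _)
            (mul_nonneg (hW0 x) (sq_nonneg _))) (sq_nonneg _)) hg
            ((ae_restrict_iff' measurableSet_Ioi).2 (ae_of_all _ fun x hx => ?_))
          beta_reduce
          have hx1 : (1 : ℝ) < x := hx
          have hx0 : 0 < x := by linarith
          have h4x : (1 : ℝ) < 4 * x := by linarith
          -- simplify the integrand
          have ed : deriv (fun y => ι y ^ 0 - B 0 y) x = -(4 * deriv U (4 * x)) := by
            simp only [pow_zero, hB]
            rw [deriv_const_sub, hBx']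
          have e0 : deriv (fun τ => B τ x) 0 = 0 := by simp only [hB, deriv_const]
          rw [ed, e0, pow_zero, neg_sq]
          simp only [hB]
          obtain ⟨hU1a, -, -⟩ := hUb (4 * x) h4x
          -- `16 U'(4x)² ≤ 36 T(4) T(4x) ≤ (9/2) R εK x^{-3/2}`
          have hTmono : ∫ s in Ioi (4 * x), q s ≤ ∫ s in Ioi 4, q s :=
            setIntegral_mono_set (hqi 4 (by norm_num))
              (ae_of_all _ fun s => (hqW s).1) (ae_of_all _ (Ioi_subset_Ioi (by linarith)))
          have hT0 : 0 ≤ ∫ s in Ioi (4 * x), q s :=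
            setIntegral_nonneg measurableSet_Ioi fun s _ => (hqW s).1
          have hd1 : (4 * deriv U (4 * x)) ^ 2 ≤ 36 * (R / 4) * (4 * εK * (4 * x) ^ (-(3 : ℝ) / 2)) := by
            have h := hU'T (4 * x) h4x
            have hsq : deriv U (4 * x) ^ 2 ≤ (3 / 2 * ∫ s in Ioi (4 * x), q s) ^ 2 := by
              rw [← sq_abs]; exact pow_le_pow_left₀ (abs_nonneg _) h 2
            have hTT : (∫ s in Ioi (4 * x), q s) ^ 2 ≤ (R / 4) * (4 * εK * (4 * x) ^ (-(3 : ℝ) / 2)) := by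
              rw [sq]
              exact mul_le_mul (hTmono.trans hT4) (hT32 (4 * x) h4x.le) hT0 (by positivity)
            nlinarith
          have e4 : (4 * x) ^ (-(3 : ℝ) / 2) = 1 / 8 * x ^ (-(3 : ℝ) / 2) := by
            rw [Real.mul_rpow (by norm_num) hx0.le]
            have : (4 : ℝ) ^ (-(3 : ℝ) / 2) = 1 / 8 := by
              rw [show (-(3 : ℝ) / 2) = -((3 : ℝ) / 2) by ring, Real.rpow_neg (by norm_num),
                show (3 : ℝ) / 2 = 1 + 1 / 2 by norm_num, Real.rpow_add (by norm_num : (0 : ℝ) < 4),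
                Real.rpow_one, ← Real.sqrt_eq_rpow, show (4 : ℝ) = 2 ^ 2 by norm_num,
                Real.sqrt_sq (by norm_num : (0 : ℝ) ≤ 2)]
              norm_num
            rw [this]
          rw [e4] at hd1
          -- `W (1 − U(4x))² ≤ 36 εK² W`
          have hd2 : W x * (1 - U (4 * x)) ^ 2 ≤ 36 * εK ^ 2 * W x := by
            have hsq : (1 - U (4 * x)) ^ 2 ≤ (12 * εK * (4 * x) ^ (-(1 : ℝ) / 2)) ^ 2 := by
              rw [← sq_abs, abs_sub_comm]; exact pow_le_pow_left₀ (abs_nonneg _) hU1a 2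
            have hh : (4 * x) ^ (-(1 : ℝ) / 2) ≤ 1 / 2 := by
              rw [Real.mul_rpow (by norm_num) hx0.le]
              have h4 : (4 : ℝ) ^ (-(1 : ℝ) / 2) = 1 / 2 := by
                rw [show (-(1 : ℝ) / 2) = -((1 : ℝ) / 2) by ring, Real.rpow_neg (by norm_num),
                  ← Real.sqrt_eq_rpow, show (4 : ℝ) = 2 ^ 2 by norm_num,
                  Real.sqrt_sq (by norm_num : (0 : ℝ) ≤ 2)]
                norm_num
              have hxh : x ^ (-(1 : ℝ) / 2) ≤ 1 :=
                Real.rpow_le_one_of_one_le_of_nonpos hx1.le (by norm_num)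
              have hxh0 : 0 ≤ x ^ (-(1 : ℝ) / 2) := Real.rpow_nonneg hx0.le _
              rw [h4]; nlinarith
            have hh0 : 0 ≤ (4 * x) ^ (-(1 : ℝ) / 2) := Real.rpow_nonneg (by linarith) _
            have hh2 : ((4 * x) ^ (-(1 : ℝ) / 2)) ^ 2 ≤ (1 / 2) ^ 2 := pow_le_pow_left₀ hh0 hh 2
            have : (12 * εK * (4 * x) ^ (-(1 : ℝ) / 2)) ^ 2 ≤ 36 * εK ^ 2 := by
              calc (12 * εK * (4 * x) ^ (-(1 : ℝ) / 2)) ^ 2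
                  = 144 * εK ^ 2 * ((4 * x) ^ (-(1 : ℝ) / 2)) ^ 2 := by ring
                _ ≤ 144 * εK ^ 2 * (1 / 2) ^ 2 := mul_le_mul_of_nonneg_left hh2 (by positivity)
                _ = 36 * εK ^ 2 := by ring
            calc W x * (1 - U (4 * x)) ^ 2 ≤ W x * (36 * εK ^ 2) :=
                  mul_le_mul_of_nonneg_left (hsq.trans this) (hW0 x)
              _ = 36 * εK ^ 2 * W x := by ring
          have e5 : 36 * (R / 4) * (4 * εK * (1 / 8 * x ^ (-(3 : ℝ) / 2)))
              = 9 / 2 * R * εK * x ^ (-(3 : ℝ) / 2) := by ring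
          rw [show (0 : ℝ) ^ 2 = 0 by norm_num, add_zero]
          linarith [hd1, hd2, e5]
      _ = 9 * R * εK + 36 * εK ^ 2 * R := hgv
      _ ≤ 10 * εK * R := by
          have h36 : 36 * εK ^ 2 * R ≤ εK * R := by
            have : 36 * εK ≤ 1 := by linarith
            have hεR : 0 ≤ εK * R := mul_nonneg hεK0.le hR0
            nlinarith
          linarith
  have hRint : (∫ x in Ioi 1, (deriv (fun y => ι y ^ 0) x ^ 2 + W x * (ι x ^ 0) ^ 2)) = R := by
    rw [hR]
    refine setIntegral_congr_fun measurableSet_Ioi fun x _ => ?_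
    simp only [pow_zero, deriv_const', one_pow, mul_one]
    ring
  refine ⟨B, hBC, fun t x hx => ?_, ?_, ?_, ?_, ⟨1, fun _ x => U (4 * x), fun z _ => by simp [hB]⟩, ?_⟩
  · -- the equation on `{x ≥ 1}`
    have e1 : iteratedDeriv 2 (fun τ => B τ x) t = 0 := by
      simp only [hB]; rw [iteratedDeriv_const]; simp
    have e2 : iteratedDeriv 2 (B t) x = 16 * (q (4 * x) * U (4 * x)) := by
      rw [iteratedDeriv_succ, iteratedDeriv_one]
      simp only [hB]
      rw [hBx']
      exact (hBxx x).deriv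
    rw [e1, e2]
    simp only [hB]
    have hq4 : q (4 * x) = W x / 16 := by
      rw [← hPsq, hPs3 (4 * x) (by linarith)]
      rw [show 4 * x / 4 = x by ring]
    rw [hq4]; ring
  · simpa only [hdens] using hint0
  · simpa only [hdens] using hT
  · simpa only [hdens] using hBo
  · rw [hRint]
    calc Real.sqrt _ ≤ Real.sqrt (10 * εK * R) := Real.sqrt_le_sqrt hmain
      _ ≤ Real.sqrt (δ ^ 2 * R) := Real.sqrt_le_sqrt
          (mul_le_mul_of_nonneg_right (by linarith [sq_nonneg δ]) hR0)
      _ = δ * Real.sqrt R := by rw [Real.sqrt_mul (sq_nonneg _), Real.sqrt_sq hδ.le]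

end Literature.Analysis.PDE
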